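import Summits.QuantumAdvantage.QuantumAdvantage.Theorems.CubicForrelationSignedExactSliceIsLiftDefs

/-!
# Stub `stub_anfCircuit` of line `Sketch` (crux K2 `SignedExactSliceIsLift`, stmt-QuantumAdvantage-14830) — part 1: the circuits

The genuine `B₂`-circuits `anfCircuit n mons : Circuit (Fin n)` behind the canonical XOR-of-ANDs netlist `anfPC n mons`
of the Defs file: the gate list is `(List.range N).map (gateAt n mons)`, `N = 2 + n + 3·#mons`, where `gateAt` is the
POSITIONAL description of the layout (constants `true`/`false`; `n` touch gates; per monomial the block `A = l₀ ∧ l₁`,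
`B = A ∧ l₂`, `X = acc ⊕ B`). This file proves: acyclicity (`gateAt_ref_lt`, so the `Circuit` structure is well formed),
`B₂` (`anfCircuit_isOver`), the touch gates read every input (`mem_readsC_anfCircuit`), and the MIRROR IDENTITY
`ForrCode.pcircOf (anfCircuit n mons) = anfPC n mons` (`pcircOf_anfCircuit`), via the positional form of the mirror
`anfGates n mons = (List.range N).map (pgAt n mons)` (`anfGates_eq_map`). The evaluation clause is part 2.
-/

set_option linter.dupNamespace false -- D-0017: single-problem summit ⇒ `QuantumAdvantage.QuantumAdvantage` by design

noncomputable section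

namespace Summit.QuantumAdvantage.QuantumAdvantage.Theorems.SignedExactSliceIsLift

open _root_.Computability Literature.Computability.Complexity Literature.Computability.Cryptography
  Literature.Computability.QuantumComplexity
open Literature.Computability.Complexity.CodeFP (strE unE natE bitE pairE rawE)

namespace StubAnfCircuit

open ForrCode Literature.Computability.MetaComplexity

variable {n : ℕ}

/-! ### The positional description of the layout -/

/-- The `p`-th literal of monomial `S` as a circuit argument: input `S[p]` if present and `< n`, the constant-`false`
gate `1` if present and out of range, the constant-`true` gate `0` if absent (mirror: `litW`). -/
def litArg (n : ℕ) (S : List ℕ) (p : ℕ) : Fin n ⊕ ℕ :=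
  if p < S.length then (if h : S.getD p 0 < n then Sum.inl ⟨S.getD p 0, h⟩ else Sum.inr 1) else Sum.inr 0

/-- The binary AND gate on two arguments. -/
def andGate (a b : Fin n ⊕ ℕ) : Gate (Fin n) := ⟨2, fun v => v 0 && v 1, ![a, b]⟩

/-- The binary XOR gate on two arguments. -/
def xorGate (a b : Fin n ⊕ ℕ) : Gate (Fin n) := ⟨2, fun v => xor (v 0) (v 1), ![a, b]⟩

/-- The first-projection gate on two arguments (reads the second one idly). -/
def projGate (a b : Fin n ⊕ ℕ) : Gate (Fin n) := ⟨2, fun v => v 0, ![a, b]⟩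

/-- The arity-`0` constant gate. -/
def constGate (n : ℕ) (c : Bool) : Gate (Fin n) := ⟨0, fun _ => c, Fin.elim0⟩

/-- **The gate at position `j`** of the canonical netlist of `mons` on `n` inputs. -/
def gateAt (n : ℕ) (mons : List (List ℕ)) (j : ℕ) : Gate (Fin n) :=
  if j = 0 then constGate n true
  else if j = 1 then constGate n false
  else if h : j - 2 < n then projGate (Sum.inr (1 + (j - 2))) (Sum.inl ⟨j - 2, h⟩)
  else if (j - (2 + n)) % 3 = 0 then
    andGate (litArg n (mons.getD ((j - (2 + n)) / 3) []) 0) (litArg n (mons.getD ((j - (2 + n)) / 3) []) 1)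
  else if (j - (2 + n)) % 3 = 1 then
    andGate (Sum.inr (2 + n + 3 * ((j - (2 + n)) / 3))) (litArg n (mons.getD ((j - (2 + n)) / 3) []) 2)
  else xorGate (Sum.inr (1 + n + 3 * ((j - (2 + n)) / 3))) (Sum.inr (3 + n + 3 * ((j - (2 + n)) / 3)))

/-- **The mirror gate at position `j`** (positional form of `anfGates`). -/
def pgAt (n : ℕ) (mons : List (List ℕ)) (j : ℕ) : PGate :=
  if j = 0 then (ttTrue, [])
  else if j = 1 then (ttFalse, [])
  else if j - 2 < n then touchGate (j - 2)
  else if (j - (2 + n)) % 3 = 0 then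
    (ttAnd, [litW n (mons.getD ((j - (2 + n)) / 3) []) 0, litW n (mons.getD ((j - (2 + n)) / 3) []) 1])
  else if (j - (2 + n)) % 3 = 1 then
    (ttAnd, [(true, 2 + n + 3 * ((j - (2 + n)) / 3)), litW n (mons.getD ((j - (2 + n)) / 3) []) 2])
  else (ttXor, [(true, 1 + n + 3 * ((j - (2 + n)) / 3)), (true, 3 + n + 3 * ((j - (2 + n)) / 3))])

/-! ### Acyclicity and the circuit -/

/-- Literal arguments refer only to the constant gates `0`, `1`. -/
theorem litArg_ref_lt_two (S : List ℕ) (p m : ℕ) (h : litArg n S p = Sum.inr m) : m < 2 := by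
  unfold litArg at h
  split_ifs at h <;> simp only [Sum.inr.injEq] at h <;> omega

/-- **Acyclicity**: gate `j` only refers to gates `m < j`. -/
theorem gateAt_ref_lt (mons : List (List ℕ)) (j : ℕ) :
    ∀ (a : Fin (gateAt n mons j).arity) (m : ℕ), (gateAt n mons j).args a = Sum.inr m → m < j := by
  by_cases h0 : j = 0
  · have e : gateAt n mons j = constGate n true := by rw [gateAt, if_pos h0]
    rw [e]; intro a; exact Fin.elim0 a
  by_cases h1 : j = 1
  · have e : gateAt n mons j = constGate n false := by rw [gateAt, if_neg h0, if_pos h1]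
    rw [e]; intro a; exact Fin.elim0 a
  by_cases ht : j - 2 < n
  · have e : gateAt n mons j = projGate (Sum.inr (1 + (j - 2))) (Sum.inl ⟨j - 2, ht⟩) := by
      rw [gateAt, if_neg h0, if_neg h1, dif_pos ht]
    rw [e]; intro a m h
    fin_cases a
    · simp only [projGate, Fin.zero_eta, Fin.isValue, Matrix.cons_val_zero, Sum.inr.injEq] at h; omega
    · simp [projGate] at h
  by_cases hA : (j - (2 + n)) % 3 = 0
  · have e : gateAt n mons j = andGate (litArg n (mons.getD ((j - (2 + n)) / 3) []) 0)
        (litArg n (mons.getD ((j - (2 + n)) / 3) []) 1) := by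
      rw [gateAt, if_neg h0, if_neg h1, dif_neg ht, if_pos hA]
    rw [e]; intro a m h
    fin_cases a
    · have := litArg_ref_lt_two _ _ _ (by simpa [andGate] using h); omega
    · have := litArg_ref_lt_two _ _ _ (by simpa [andGate] using h); omega
  by_cases hB : (j - (2 + n)) % 3 = 1
  · have e : gateAt n mons j = andGate (Sum.inr (2 + n + 3 * ((j - (2 + n)) / 3)))
        (litArg n (mons.getD ((j - (2 + n)) / 3) []) 2) := by
      rw [gateAt, if_neg h0, if_neg h1, dif_neg ht, if_neg hA, if_pos hB]
    rw [e]; intro a m h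
    fin_cases a
    · simp only [andGate, Fin.zero_eta, Fin.isValue, Matrix.cons_val_zero, Sum.inr.injEq] at h; omega
    · have := litArg_ref_lt_two _ _ _ (by simpa [andGate] using h); omega
  · have e : gateAt n mons j = xorGate (Sum.inr (1 + n + 3 * ((j - (2 + n)) / 3)))
        (Sum.inr (3 + n + 3 * ((j - (2 + n)) / 3))) := by
      rw [gateAt, if_neg h0, if_neg h1, dif_neg ht, if_neg hA, if_neg hB]
    rw [e]; intro a m h
    fin_cases a
    · simp only [xorGate, Fin.zero_eta, Fin.isValue, Matrix.cons_val_zero, Sum.inr.injEq] at h; omega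
    · simp [xorGate] at h; omega

/-- The number of gates: `2 + n + 3·#mons`. -/
def N (n : ℕ) (mons : List (List ℕ)) : ℕ := 2 + n + 3 * mons.length

/-- **The canonical circuit** of a monomial list on `n` inputs (output: the last accumulator). -/
def anfCircuit (n : ℕ) (mons : List (List ℕ)) : Circuit (Fin n) where
  gates := (List.range (N n mons)).map (gateAt n mons)
  output := Sum.inr (1 + n + 3 * mons.length)
  wf := by
    intro j hj a m h
    rw [List.length_map, List.length_range] at hj
    have e : ((List.range (N n mons)).map (gateAt n mons))[j] = gateAt n mons j := by
      rw [List.getElem_map, List.getElem_range]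
    -- transport `a` along `e`
    revert a
    rw [e]
    intro a h
    exact gateAt_ref_lt mons j a m h
  wf_output := by
    intro m hm
    simp only [Sum.inr.injEq] at hm
    rw [List.length_map, List.length_range, N]
    omega

/-- The gate list of the canonical circuit. -/
theorem anfCircuit_gates (mons : List (List ℕ)) : (anfCircuit n mons).gates = (List.range (N n mons)).map (gateAt n mons) := rfl

/-- **`B₂`**: every gate has fan-in `0` or `2`. -/
theorem anfCircuit_isOver (mons : List (List ℕ)) : (anfCircuit n mons).IsOver B2 := by
  intro g hg
  rw [anfCircuit_gates, List.mem_map] at hg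
  obtain ⟨j, -, rfl⟩ := hg
  show (gateAt n mons j).arity ≤ 2
  unfold gateAt
  split_ifs <;> simp [constGate, projGate, andGate, xorGate]

/-- **Every input wire is read** (by its touch gate). -/
theorem mem_readsC_anfCircuit (mons : List (List ℕ)) (j : ℕ) (hj : j < n) : j ∈ ForrMem.readsC (anfCircuit n mons) := by
  rw [ForrMem.readsC, List.mem_append, anfCircuit_gates]
  refine Or.inl (List.mem_flatMap.2 ⟨gateAt n mons (2 + j), List.mem_map.2 ⟨2 + j, ?_, rfl⟩, ?_⟩)
  · rw [List.mem_range, N]; omega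
  · have hg : gateAt n mons (2 + j) = projGate (Sum.inr (1 + j)) (Sum.inl ⟨j, hj⟩) := by
      unfold gateAt
      rw [if_neg (by omega), if_neg (by omega), dif_pos (by simpa using hj)]
      simp
    rw [hg, ForrMem.readsG]
    simp [projGate, List.ofFn_succ, ForrMem.inlIdx]

/-! ### The mirror identity -/

/-- The mirror of a gate reference. -/
theorem wireOf_inr (m : ℕ) : wireOf (Sum.inr m : Fin n ⊕ ℕ) = (true, m) := rfl

/-- The mirror of an input reference. -/
theorem wireOf_inl (i : Fin n) : wireOf (Sum.inl i : Fin n ⊕ ℕ) = (false, i.val) := rfl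

/-- The mirror of a literal argument is `litW`. -/
theorem wireOf_litArg (S : List ℕ) (p : ℕ) : wireOf (litArg n S p) = litW n S p := by
  unfold litArg litW
  split_ifs <;> rfl

/-- Truth table of the first projection. -/
theorem truthTable_proj : truthTable (fun v : Fin 2 → Bool => v 0) = ttProj := by decide

/-- Truth table of AND. -/
theorem truthTable_and : truthTable (fun v : Fin 2 → Bool => v 0 && v 1) = ttAnd := by decide

/-- Truth table of XOR. -/
theorem truthTable_xor : truthTable (fun v : Fin 2 → Bool => xor (v 0) (v 1)) = ttXor := by decide

/-- Truth table of the constant `true`. -/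
theorem truthTable_true : truthTable (fun _ : Fin 0 → Bool => true) = ttTrue := by decide

/-- Truth table of the constant `false`. -/
theorem truthTable_false : truthTable (fun _ : Fin 0 → Bool => false) = ttFalse := by decide

/-- **Gate by gate, the mirror of `gateAt` is `pgAt`.** -/
theorem pgateOf_gateAt (mons : List (List ℕ)) (j : ℕ) : pgateOf (gateAt n mons j) = pgAt n mons j := by
  unfold gateAt pgAt
  split_ifs <;>
    simp [pgateOf, constGate, projGate, andGate, xorGate, truthTable_true, truthTable_false, truthTable_proj,
      truthTable_and, truthTable_xor, touchGate, List.ofFn_succ, wireOf_litArg, wireOf_inr, wireOf_inl]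

/-- Splitting a range of length `3M` into consecutive triples. -/
theorem map_range_three_mul {α : Type} (g : ℕ → α) : ∀ M : ℕ,
    (List.range (3 * M)).map g = (List.range M).flatMap fun m => [g (3 * m), g (3 * m + 1), g (3 * m + 2)]
  | 0 => rfl
  | M + 1 => by
    have h3 : List.range 3 = [0, 1, 2] := by decide
    rw [show 3 * (M + 1) = 3 * M + 3 by ring, List.range_add, List.map_append, map_range_three_mul g M, h3,
      List.range_succ, List.flatMap_append]
    simp

/-- The two constant gates, positionally. -/
theorem map_pgAt_two (mons : List (List ℕ)) : (List.range 2).map (pgAt n mons) = [(ttTrue, []), (ttFalse, [])] := by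
  have h2 : List.range 2 = [0, 1] := by decide
  rw [h2]
  simp [pgAt]

/-- The touch gates, positionally. -/
theorem map_pgAt_touch (mons : List (List ℕ)) :
    ((List.range n).map fun x => 2 + x).map (pgAt n mons) = (List.range n).map touchGate := by
  rw [List.map_map]
  refine List.map_congr_left fun j hj => ?_
  rw [List.mem_range] at hj
  simp only [Function.comp_apply, pgAt]
  rw [if_neg (by omega), if_neg (by omega), if_pos (by omega)]
  simp

/-- The three gates of block `m`, positionally. -/
theorem pgAt_block (mons : List (List ℕ)) (m s : ℕ) (hs : s < 3) :
    pgAt n mons (2 + n + (3 * m + s)) = (blockGates n m (mons.getD m [])).getD s (ttTrue, []) := by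
  simp only [pgAt]
  rw [if_neg (by omega), if_neg (by omega), if_neg (by omega),
    show 2 + n + (3 * m + s) - (2 + n) = 3 * m + s by omega,
    show (3 * m + s) / 3 = m by omega, show (3 * m + s) % 3 = s by omega]
  interval_cases s <;> simp [blockGates]

/-- The monomial blocks, positionally. -/
theorem map_pgAt_blocks (mons : List (List ℕ)) :
    ((List.range (3 * mons.length)).map fun x => 2 + n + x).map (pgAt n mons) =
      (List.range mons.length).flatMap fun m => blockGates n m (mons.getD m []) := by
  rw [List.map_map, show ((pgAt n mons) ∘ fun x => 2 + n + x) = fun r => pgAt n mons (2 + n + r) from rfl,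
    map_range_three_mul]
  refine List.flatMap_congr fun m _ => ?_
  have k0 := pgAt_block (n := n) mons m 0 (by omega)
  have k1 := pgAt_block (n := n) mons m 1 (by omega)
  have k2 := pgAt_block (n := n) mons m 2 (by omega)
  rw [Nat.add_zero] at k0
  rw [k0, k1, k2]
  simp [blockGates]

/-- **The positional form of the mirror gate list.** -/
theorem anfGates_eq_map (mons : List (List ℕ)) : anfGates n mons = (List.range (N n mons)).map (pgAt n mons) := by
  rw [N, List.range_add, List.range_add, List.map_append, List.map_append, map_pgAt_two, map_pgAt_touch,
    map_pgAt_blocks, anfGates]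

/-- **The mirror identity**: `pcircOf (anfCircuit n mons) = anfPC n mons`. -/
theorem pcircOf_anfCircuit (mons : List (List ℕ)) : pcircOf (anfCircuit n mons) = anfPC n mons := by
  rw [pcircOf, anfPC, anfCircuit_gates, List.map_map, anfGates_eq_map]
  refine Prod.ext (List.map_congr_left fun j _ => pgateOf_gateAt mons j) ?_
  rfl

end StubAnfCircuit

end Summit.QuantumAdvantage.QuantumAdvantage.Theorems.SignedExactSliceIsLift

end
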